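import Summits.BirchSwinnertonDyer.BirchSwinnertonDyer.Theorems.KimAtThreeShallowEqDeepDictionary
import Summits.BirchSwinnertonDyer.BirchSwinnertonDyer.Theorems.KimAtThreeDeepLowerExoticRows
import HarnessLib

/-!
# Route `KimAtThreeKolyvagin` (rung W2), crux `ShallowEqDeepAtTorsionFree`: the crux in Mazur–Rubin's
# LEVEL-`k` currency — "no dip of `∂^{(i)}(δ̃^{(k)})` below `min(k, ∂^{(∞)}_{deep})`"

Item `stmt-BirchSwinnertonDyer-19077` compares two DIFFERENT infinite functionals of the collection of
Kurihara numbers `δ̃ = {δ̃_n}`: the deep limit `∂^{(∞)}_{deep}(δ̃) = min_i lim_k ∂^{(i)}(δ̃^{(k)})`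
(`kuriharaPartialDeepInfty`, Mazur–Rubin Def. 4.5.7 / Thm. 5.2.12 (i) shape) and the all-levels infimum
`∂^{(∞)}(δ̃) = min_i min_n ord_p δ̃_n` (`kuriharaPartialInfty`, Kim Def. 2.13). This file removes the
all-levels functional from the statement: the crux's conclusion on a row is EQUIVALENT to a property of
the single non-decreasing sequences `k ↦ ∂^{(i)}(δ̃^{(k)})` (`kuriharaPartialDeepAt _ _ _ k i`) alone,
namely that they never dip below the capped deep limit,

  `∂^{(∞)}_{deep}(δ̃) ≤ ∂^{(∞)}(δ̃)  ⟺  ∀ i k, min(k, ∂^{(∞)}_{deep}(δ̃)) ≤ ∂^{(i)}(δ̃^{(k)})`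

(`kuriharaPartialDeepInfty_le_kuriharaPartialInfty_iff_forall_min_le_deepAt`), and likewise per `i`:
Kim's printed identity "`∂^{(i)}(δ̃) = lim_{k→∞} ∂^{(i)}(δ̃^{(k)})`" (AJM 148 §1.5.1) holds on a row iff
`∀ k, min(k, ∂^{(i)}_{deep}) ≤ ∂^{(i)}(δ̃^{(k)})` (`kuriharaPartial_eq_kuriharaPartialDeep_iff`). For a
genuine Kolyvagin system this regularity is Mazur–Rubin's Thm. 5.2.12 (i)–(ii) read together with
Thm. 4.5.6 (the stub property at EVERY level); for the Kurihara numbers it is exactly what the crux asks.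
At `i = 0` the regularity is automatic (`kuriharaPartialDeepAt_zero_eq` and w2-c2's
`kuriharaPartialDeep_zero_eq_kuriharaPartial_zero`: the only level is `n = 1`), so the crux's content begins at `ν(n) = i ≥ 1`
(`…_iff_forall_min_le_deepAt_pos`). Item-level forms: `shallowEqDeepAtTorsionFree_iff_levelRegular`
(the crux decl ⟺ its level-`k` restatement, verbatim binders) and
`shallowEqDeepAtTorsionFree_of_forall_partial_eq_deep` (Kim's per-`i` identity on every row ⟹ the crux).

Everything is general `p`, pure `ℕ∞` bookkeeping over the tree's definitions (`KuriharaNumberInvariants`,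
`KuriharaNumberDeepInvariants`) and the index-structure lemma `coe_le_kuriharaDivIndex_of_forall_min_le`
of the sibling file `KimAtThreeShallowEqDeepDictionary`; nothing is asserted, no crux is proved, no mark
moves. [cite: MazurRubin2004, Def. 4.5.7, Def. 5.2.11, Thm. 5.2.12 (i)–(ii), Thm. 4.5.6]
[cite: Kim2022StructureSelmer, §1.5.1 (PDF p. 7), Def. 2.13 (PDF p. 14)] [cite: Kim2025RefinedTNC, Thm 1.1]
-/

set_option autoImplicit false
-- the Theorems namespace of a single-conjunct summit repeats the summit name by design (D-0017)
set_option linter.dupNamespace false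

noncomputable section

open scoped MatrixGroups ModularForm Classical

open CongruenceSubgroup WeierstrassCurve Literature.NumberTheory.EllipticCurves
  Literature.NumberTheory.EllipticCurves.ModularForms

namespace Summit.BirchSwinnertonDyer.BirchSwinnertonDyer.Theorems.KimAtThreeShallowEqDeepLevelRegularity

open Summit.BirchSwinnertonDyer.BirchSwinnertonDyer.Theses.KimAtThreeKolyvagin
open Summit.BirchSwinnertonDyer.BirchSwinnertonDyer.Theorems.KimAtThreeKolyvaginCertificateDictionary
open Summit.BirchSwinnertonDyer.BirchSwinnertonDyer.Theorems.KimAtThreeShallowEqDeepDictionary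
open Summit.BirchSwinnertonDyer.BirchSwinnertonDyer.Theorems.KimAtThreeDeepLowerExoticRows

/-! ### One index `i`: all-levels `∂^{(i)}` versus the sequence `∂^{(i)}(δ̃^{(k)})` (general `p`) -/

section Partial

variable (W : WeierstrassCurve ℚ) [W.IsGloballyMinimal] (p : ℕ) {N : ℕ} (f : CuspForm (Gamma0 N) 2)

/-- `min(k, ∂^{(i)}(δ̃)) ≤ ∂^{(i)}(δ̃^{(k)})`: every term `min(k, ord_p δ̃_n)` of the level-`k` infimum
dominates `min(k, ∂^{(i)})` (the all-levels infimum sees MORE levels, uncapped).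
[cite: MazurRubin2004, Def. 4.5.7] [cite: Kim2022StructureSelmer, Def. 2.13 (PDF p. 14)] -/
theorem min_kuriharaPartial_le_kuriharaPartialDeepAt (k i : ℕ) :
    min (k : ℕ∞) (kuriharaPartial W p f i) ≤ kuriharaPartialDeepAt W p f k i := by
  rw [kuriharaPartialDeepAt_def]
  refine le_iInf fun n => le_iInf fun hn => le_iInf fun _ => le_iInf fun hi => ?_
  exact min_le_min le_rfl (kuriharaPartial_le W p f hn hi)

/-- A bound `c ≤ ∂^{(i)}(δ̃)` gives `min(k, c) ≤ ∂^{(i)}(δ̃^{(k)})` at every depth `k`.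
[cite: MazurRubin2004, Def. 4.5.7] -/
theorem min_le_kuriharaPartialDeepAt_of_le_kuriharaPartial {c : ℕ∞} {i : ℕ}
    (h : c ≤ kuriharaPartial W p f i) (k : ℕ) :
    min (k : ℕ∞) c ≤ kuriharaPartialDeepAt W p f k i :=
  (min_le_min le_rfl h).trans (min_kuriharaPartial_le_kuriharaPartialDeepAt W p f k i)

/-- **No dip at every depth is a bound on the all-levels `∂^{(i)}`.** If `min(k, c) ≤ ∂^{(i)}(δ̃^{(k)})`
for EVERY depth `k`, then `c ≤ ∂^{(i)}(δ̃)`: for a cyclic level `n` with `ν(n) = i` the hypothesis at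
each admissible depth `k` (`n ∈ 𝒩_k`) reads `min(k, c) ≤ min(k, ord_p δ̃_n)`, and a bound at every
admissible depth is a bound on the index (`coe_le_kuriharaDivIndex_of_forall_min_le`: the certificate
behind a finite index `m` lives at the admissible depth `m + 1`).
[cite: Kim2022StructureSelmer, §1.5.1 (PDF p. 7), Def. 2.13 (PDF p. 14)] [cite: MazurRubin2004, Def. 4.5.7] -/
theorem coe_le_kuriharaPartial_of_forall_min_le_deepAt {c i : ℕ}
    (h : ∀ k : ℕ, min (k : ℕ∞) (c : ℕ∞) ≤ kuriharaPartialDeepAt W p f k i) :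
    (c : ℕ∞) ≤ kuriharaPartial W p f i := by
  rw [kuriharaPartial_def]
  refine le_iInf fun n => le_iInf fun hn => le_iInf fun hi => ?_
  refine coe_le_kuriharaDivIndex_of_forall_min_le W p f fun k hk => ?_
  exact (h k).trans ((kuriharaPartialDeepAt_le W p f hn hk hi).trans (min_le_right _ _))

/-- The same for a bound `c : ℕ∞` (the case `c = ⊤` says: full divisibility at every depth forces every
index to be `⊤`). [cite: Kim2022StructureSelmer, Def. 2.13 (PDF p. 14)] -/
theorem le_kuriharaPartial_of_forall_min_le_deepAt {c : ℕ∞} {i : ℕ}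
    (h : ∀ k : ℕ, min (k : ℕ∞) c ≤ kuriharaPartialDeepAt W p f k i) :
    c ≤ kuriharaPartial W p f i := by
  induction c using ENat.recTopCoe with
  | top =>
    -- every natural bound holds, so the all-levels invariant is `⊤`
    have htop : kuriharaPartial W p f i = ⊤ := by
      rw [ENat.eq_top_iff_forall_ge]
      intro m
      refine coe_le_kuriharaPartial_of_forall_min_le_deepAt W p f fun k => ?_
      exact (min_le_min le_rfl le_top).trans (h k)
    rw [htop]
  | coe c => exact coe_le_kuriharaPartial_of_forall_min_le_deepAt W p f h

/-- **`c ≤ ∂^{(i)}(δ̃) ⟺ min(k, c) ≤ ∂^{(i)}(δ̃^{(k)})` for every depth `k`.**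
[cite: MazurRubin2004, Def. 4.5.7, Thm. 5.2.12 (i)] [cite: Kim2022StructureSelmer, Def. 2.13 (PDF p. 14)] -/
theorem le_kuriharaPartial_iff_forall_min_le_deepAt (c : ℕ∞) (i : ℕ) :
    c ≤ kuriharaPartial W p f i ↔ ∀ k : ℕ, min (k : ℕ∞) c ≤ kuriharaPartialDeepAt W p f k i :=
  ⟨fun h k => min_le_kuriharaPartialDeepAt_of_le_kuriharaPartial W p f h k,
    le_kuriharaPartial_of_forall_min_le_deepAt W p f⟩

/-- **Kim's printed identity `∂^{(i)}(δ̃) = lim_k ∂^{(i)}(δ̃^{(k)})` on a row ⟺ NO DIP**: the all-levels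
`∂^{(i)}` equals the deep `∂^{(i)}_{deep}` iff `min(k, ∂^{(i)}_{deep}) ≤ ∂^{(i)}(δ̃^{(k)})` at every depth
`k` (the inequality `∂^{(i)} ≤ ∂^{(i)}_{deep}` always holds, `kuriharaPartial_le_kuriharaPartialDeep`). For
a Kolyvagin system this is Mazur–Rubin Thm. 5.2.12 (i) together with the stub property Thm. 4.5.6 at
every level; for the Kurihara numbers it is an ASSERTION (Kim AJM 148 §1.5.1 "`= lim_{k→∞} ∂^{(i)}(δ̃^{(k)})`").
[cite: Kim2022StructureSelmer, §1.5.1 (PDF p. 7)] [cite: MazurRubin2004, Thm. 5.2.12 (i), Thm. 4.5.6] -/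
theorem kuriharaPartial_eq_kuriharaPartialDeep_iff (i : ℕ) :
    kuriharaPartial W p f i = kuriharaPartialDeep W p f i ↔
      ∀ k : ℕ, min (k : ℕ∞) (kuriharaPartialDeep W p f i) ≤ kuriharaPartialDeepAt W p f k i := by
  rw [← le_kuriharaPartial_iff_forall_min_le_deepAt]
  exact ⟨fun h => h.ge, fun h => le_antisymm (kuriharaPartial_le_kuriharaPartialDeep W p f i) h⟩

end Partial

/-! ### The level `n = 1` (`i = 0`): the regularity is automatic -/

section Zero

variable (W : WeierstrassCurve ℚ) [W.IsGloballyMinimal] (p : ℕ) {N : ℕ} (f : CuspForm (Gamma0 N) 2)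

/-- **`∂^{(0)}(δ̃^{(k)}) = min(k, ord_p δ̃_1)`**: the only square-free level without prime factors is
`n = 1`, which is cyclic and lies in every `𝒩_k`. [cite: MazurRubin2004, Def. 4.5.7]
[cite: Kim2022StructureSelmer, §1.4.2 and §1.5.1 (PDF p. 7)] -/
theorem kuriharaPartialDeepAt_zero_eq (k : ℕ) :
    kuriharaPartialDeepAt W p f k 0 = min (k : ℕ∞) (kuriharaDivIndex W p f 1) := by
  refine le_antisymm (kuriharaPartialDeepAt_le W p f (isCyclicKolyvaginLevel_one W p)
    Kato.IsKolyvaginProduct.one (by rw [Nat.primeFactors_one, Finset.card_empty])) ?_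
  rw [kuriharaPartialDeepAt_def]
  refine le_iInf fun n => le_iInf fun hn => le_iInf fun _ => le_iInf fun hi => ?_
  rcases Nat.primeFactors_eq_empty.mp (Finset.card_eq_zero.mp hi) with h0 | rfl
  · exact absurd h0 hn.1.ne_zero
  · exact le_rfl

/-- At `i = 0` the no-dip condition holds for the deep limit: `min(k, ∂^{(∞)}_{deep}) ≤ ∂^{(0)}(δ̃^{(k)})`
for every `k` (since `∂^{(∞)}_{deep} ≤ ∂^{(0)}_{deep} = ∂^{(0)}`). [cite: MazurRubin2004, Def. 5.2.11] -/
theorem min_kuriharaPartialDeepInfty_le_kuriharaPartialDeepAt_zero (k : ℕ) :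
    min (k : ℕ∞) (kuriharaPartialDeepInfty W p f) ≤ kuriharaPartialDeepAt W p f k 0 :=
  min_le_kuriharaPartialDeepAt_of_le_kuriharaPartial W p f
    ((kuriharaPartialDeepInfty_le W p f 0).trans (kuriharaPartialDeep_zero_eq_kuriharaPartial_zero W p f).le) k

end Zero

/-! ### The crux's conclusion on one row in level-`k` currency (general `p`) -/

section Row

variable (W : WeierstrassCurve ℚ) [W.IsGloballyMinimal] (p : ℕ) {N : ℕ} (f : CuspForm (Gamma0 N) 2)

/-- `c ≤ ∂^{(∞)}(δ̃) ⟺ min(k, c) ≤ ∂^{(i)}(δ̃^{(k)})` for every `i` and every depth `k`.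
[cite: MazurRubin2004, Def. 4.5.7, Def. 5.2.11] [cite: Kim2022StructureSelmer, §1.5.1 (PDF p. 7)] -/
theorem le_kuriharaPartialInfty_iff_forall_min_le_deepAt (c : ℕ∞) :
    c ≤ kuriharaPartialInfty W p f ↔ ∀ i k : ℕ, min (k : ℕ∞) c ≤ kuriharaPartialDeepAt W p f k i := by
  unfold kuriharaPartialInfty
  rw [le_iInf_iff]
  exact forall_congr' fun i => le_kuriharaPartial_iff_forall_min_le_deepAt W p f c i

/-- **The crux's conclusion ⟺ NO DIP of the level-`k` invariants below the capped deep limit**: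
`∂^{(∞)}_{deep}(δ̃) ≤ ∂^{(∞)}(δ̃)` iff `min(k, ∂^{(∞)}_{deep}(δ̃)) ≤ ∂^{(i)}(δ̃^{(k)})` for every `i` and
`k` — i.e. at depths `k ≤ ∂^{(∞)}_{deep}` every Kurihara number at every cyclic `n ∈ 𝒩_k` vanishes mod
`p^k`, and at depths `k > ∂^{(∞)}_{deep}` every one is divisible by `p^{∂^{(∞)}_{deep}}` mod `p^k`. The
all-levels functional `kuriharaPartialInfty` no longer appears: the crux is a regularity property of the
Mazur–Rubin sequences `∂^{(i)}(δ̃^{(k)})` alone (their limits dominate `∂^{(∞)}_{deep}` by definition; the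
crux forbids the non-decreasing sequences to start lower than the capped limit).
[cite: MazurRubin2004, Def. 4.5.7, Def. 5.2.11, Thm. 5.2.12 (i)–(ii)] [cite: Kim2025RefinedTNC, Thm 1.1] -/
theorem kuriharaPartialDeepInfty_le_kuriharaPartialInfty_iff_forall_min_le_deepAt :
    kuriharaPartialDeepInfty W p f ≤ kuriharaPartialInfty W p f ↔
      ∀ i k : ℕ, min (k : ℕ∞) (kuriharaPartialDeepInfty W p f) ≤ kuriharaPartialDeepAt W p f k i :=
  le_kuriharaPartialInfty_iff_forall_min_le_deepAt W p f _

/-- **… and only the indices `i ≥ 1` carry content** (at `i = 0` the condition is automatic,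
`min_kuriharaPartialDeepInfty_le_kuriharaPartialDeepAt_zero`). [cite: MazurRubin2004, Def. 5.2.11]
[cite: Kim2022StructureSelmer, §1.5.1 (PDF p. 7)] -/
theorem kuriharaPartialDeepInfty_le_kuriharaPartialInfty_iff_forall_min_le_deepAt_pos :
    kuriharaPartialDeepInfty W p f ≤ kuriharaPartialInfty W p f ↔
      ∀ i k : ℕ, 0 < i → min (k : ℕ∞) (kuriharaPartialDeepInfty W p f) ≤ kuriharaPartialDeepAt W p f k i := by
  rw [kuriharaPartialDeepInfty_le_kuriharaPartialInfty_iff_forall_min_le_deepAt]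
  refine ⟨fun h i k _ => h i k, fun h i k => ?_⟩
  rcases Nat.eq_zero_or_pos i with rfl | hi
  · exact min_kuriharaPartialDeepInfty_le_kuriharaPartialDeepAt_zero W p f k
  · exact h i k hi

/-- **Kim's per-`i` identity implies the crux's conclusion**: if `∂^{(i)}(δ̃) = ∂^{(i)}_{deep}(δ̃)` for
every `i ≥ 1` then `∂^{(∞)}_{deep}(δ̃) ≤ ∂^{(∞)}(δ̃)` (indeed `=`; `i = 0` is free). The converse fails as
bookkeeping: the crux only constrains the MINIMUM over `i`. [cite: Kim2022StructureSelmer, §1.5.1 (PDF p. 7)]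
[cite: MazurRubin2004, Def. 5.2.11] -/
theorem kuriharaPartialDeepInfty_le_kuriharaPartialInfty_of_forall_partial_eq_deep
    (h : ∀ i, 0 < i → kuriharaPartial W p f i = kuriharaPartialDeep W p f i) :
    kuriharaPartialDeepInfty W p f ≤ kuriharaPartialInfty W p f := by
  refine le_iInf fun i => ?_
  rcases Nat.eq_zero_or_pos i with rfl | hi
  · exact (kuriharaPartialDeepInfty_le W p f 0).trans (kuriharaPartialDeep_zero_eq_kuriharaPartial_zero W p f).le
  · rw [h i hi]
    exact kuriharaPartialDeepInfty_le W p f i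

/-- Under the per-`i` identity the two infinite functionals AGREE. [cite: Kim2022StructureSelmer, §1.5.1 (PDF p. 7)] -/
theorem kuriharaPartialDeepInfty_eq_kuriharaPartialInfty_of_forall_partial_eq_deep
    (h : ∀ i, 0 < i → kuriharaPartial W p f i = kuriharaPartialDeep W p f i) :
    kuriharaPartialDeepInfty W p f = kuriharaPartialInfty W p f :=
  le_antisymm (kuriharaPartialDeepInfty_le_kuriharaPartialInfty_of_forall_partial_eq_deep W p f h)
    (kuriharaPartialInfty_le_kuriharaPartialDeepInfty W p f)

/-- **Failure form (the route's kill criterion in level-`k` currency)**: the crux's conclusion fails on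
a row iff some sequence dips — some `i ≥ 1` and depth `k` with
`∂^{(i)}(δ̃^{(k)}) < min(k, ∂^{(∞)}_{deep}(δ̃))`, i.e. (by `kuriharaPartialDeepAt_le_coe_iff`) a cyclic
`n ∈ 𝒩_k` with `ν(n) = i` carrying a certificate of depth `≤ min(k, ∂^{(∞)}_{deep})`.
[cite: Kim2025RefinedTNC, Thm 1.1] [cite: MazurRubin2004, Def. 4.5.7] -/
theorem not_kuriharaPartialDeepInfty_le_kuriharaPartialInfty_iff_exists_dip :
    ¬ kuriharaPartialDeepInfty W p f ≤ kuriharaPartialInfty W p f ↔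
      ∃ i k : ℕ, 0 < i ∧ kuriharaPartialDeepAt W p f k i < min (k : ℕ∞) (kuriharaPartialDeepInfty W p f) := by
  rw [kuriharaPartialDeepInfty_le_kuriharaPartialInfty_iff_forall_min_le_deepAt_pos]
  push Not
  exact ⟨fun ⟨i, k, hi, h⟩ => ⟨i, k, hi, h⟩, fun ⟨i, k, hi, h⟩ => ⟨i, k, hi, h⟩⟩

end Row

/-! ### Off the `3`-adic tower (exotic rows): the crux's conclusion reads "`∂^{(∞)}(δ̃) = ∂⁽⁰⁾(δ̃)`" -/

section Exotic

variable (W : WeierstrassCurve ℚ) [W.IsElliptic] [W.IsGloballyMinimal] {N : ℕ}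
  (f : CuspForm (Gamma0 N) 2)

/-- **Tightness of the tower binder of item 19077 (`ShallowEqDeepAtTorsionFree`).** On an EXOTIC row
(`ρ̄_{E,3}` onto, `ρ̄_{E,9}` not: the 21 Elkies classes, outside the route) the deep limit collapses to
`∂⁽⁰⁾(δ̃)` (w2-c2's `kuriharaPartialDeepInfty_three_eq_kuriharaPartial_zero_of_exotic`: no cyclic level of
depth `≥ 2` exists), so the crux's conclusion `∂^{(∞)}_{deep} ≤ ∂^{(∞)}` there is EQUIVALENT to
`∂^{(∞)}(δ̃) = ∂⁽⁰⁾(δ̃)`: every Kurihara number at every cyclic level is at least as `3`-divisible as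
`δ̃_1 = [0]⁺_f` (or vanishes to the depth of its level) — one unit `δ̃_n` at a cyclic level of a row with
`3 ∣ [0]⁺_f` falsifies it. Were the tower binder dropped, these rows would join the crux with this
reading (compare `deepLower_conclusion_of_exotic` / `deepUpper_conclusion_iff_of_exotic` for items
19075/19076). [cite: MazurRubin2004, Def. 5.2.11] [cite: Kim2022StructureSelmer, §1.5.1 (PDF p. 7)]
[cite: Elkies2006, Theorem (the 9-deficient 3-adic image)] -/
theorem shallowEqDeep_conclusion_iff_of_exotic (hsurj : W.HasSurjectiveModNGaloisRep 3)
    (hns9 : ¬ W.HasSurjectiveModNGaloisRep 9) :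
    kuriharaPartialDeepInfty W 3 f ≤ kuriharaPartialInfty W 3 f ↔
      kuriharaPartialInfty W 3 f = kuriharaPartial W 3 f 0 := by
  rw [kuriharaPartialDeepInfty_three_eq_kuriharaPartial_zero_of_exotic W f hsurj hns9]
  exact ⟨fun h => le_antisymm (kuriharaPartialInfty_le W 3 f 0) h, fun h => h.ge⟩

/-- … equivalently `ord₃ δ̃_1 ≤ ord₃ δ̃_n` for EVERY cyclic level `n` (the all-levels infimum is attained
at `n = 1`). [cite: Kim2022StructureSelmer, §1.5.1 (PDF p. 7), Def. 2.13 (PDF p. 14)] -/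
theorem shallowEqDeep_conclusion_iff_forall_level_of_exotic (hsurj : W.HasSurjectiveModNGaloisRep 3)
    (hns9 : ¬ W.HasSurjectiveModNGaloisRep 9) :
    kuriharaPartialDeepInfty W 3 f ≤ kuriharaPartialInfty W 3 f ↔
      ∀ n i, IsCyclicKolyvaginLevel W 3 n → n.primeFactors.card = i →
        kuriharaDivIndex W 3 f 1 ≤ kuriharaDivIndex W 3 f n := by
  rw [kuriharaPartialDeepInfty_three_eq_kuriharaPartial_zero_of_exotic W f hsurj hns9,
    kuriharaPartial_zero]
  constructor
  · intro h n i hn hi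
    exact h.trans ((kuriharaPartialInfty_le W 3 f i).trans (kuriharaPartial_le W 3 f hn hi))
  · intro h
    refine le_iInf fun i => ?_
    rw [kuriharaPartial_def]
    exact le_iInf fun n => le_iInf fun hn => le_iInf fun hi => h n i hn hi

end Exotic

/-! ### Item level: the crux decl ⟺ its level-`k` restatement; Kim's per-`i` identity ⟹ the crux -/

/-- **Crux `ShallowEqDeepAtTorsionFree` ⟺ LEVEL REGULARITY on every row of the route** (same binders,
verbatim): for every `i ≥ 1` and every depth `k`, `min(k, ∂^{(∞)}_{deep}(δ̃)) ≤ ∂^{(i)}(δ̃^{(k)})`. The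
restatement mentions only Mazur–Rubin's level-`k` invariants `kuriharaPartialDeepAt W 3 f k i` and their
limit functional `kuriharaPartialDeepInfty W 3 f`; it is the tree's form of "the image of the Kurihara
numbers in every `KS(T/3^k, 𝒫_k)`-currency is at least as divisible as the limit predicts" (MR Thm.
5.2.12 (i) with the stub property Thm. 4.5.6 at every finite level, for Kato's system transported by
the `t = 0` dictionary). Nothing asserted; the item stays open. [cite: MazurRubin2004, Thm. 5.2.12 (i), Thm. 4.5.6]
[cite: Kim2025RefinedTNC, Thm 1.1] [cite: Kim2022StructureSelmer, §1.5.1 (PDF p. 7)] -/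
theorem shallowEqDeepAtTorsionFree_iff_levelRegular :
    ShallowEqDeepAtTorsionFree ↔
      ∀ (W : WeierstrassCurve ℚ) [W.IsElliptic] [W.IsGloballyMinimal],
        (∀ n : ℕ, W.HasSurjectiveModNGaloisRep (3 ^ n : ℕ)) →
        Nat.card {Q : (W.baseChange ℚ_[3]).toAffine.Point // (3 : ℕ) • Q = 0} = 1 → Finite W.sha →
        ∀ {N : ℕ} [NeZero N] (f : CuspForm (Gamma0 N) 2), IsNewformOf W f →
        (∀ r : ℚ, ratPlusSymbol f r ≠ 0 → 0 ≤ padicValRat 3 (ratPlusSymbol f r)) →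
        kuriharaVanishingOrder W 3 f = 0 →
        ∀ i k : ℕ, 0 < i →
          min (k : ℕ∞) (kuriharaPartialDeepInfty W 3 f) ≤ kuriharaPartialDeepAt W 3 f k i := by
  constructor
  · intro h W _ _ htower ht0 hfin N _ f hf hint hord
    exact (kuriharaPartialDeepInfty_le_kuriharaPartialInfty_iff_forall_min_le_deepAt_pos W 3 f).mp
      (h W htower ht0 hfin f hf hint hord)
  · intro h W _ _ htower ht0 hfin N _ f hf hint hord
    exact (kuriharaPartialDeepInfty_le_kuriharaPartialInfty_iff_forall_min_le_deepAt_pos W 3 f).mpr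
      (h W htower ht0 hfin f hf hint hord)

/-- **Crux `ShallowEqDeepAtTorsionFree` ⟸ Kim's per-`i` identity `∂^{(i)}(δ̃) = ∂^{(i)}_{deep}(δ̃)`
(`i ≥ 1`) on every row of the route** — the statement printed in Kim AJM 148 §1.5.1 ("`∂^{(i)}(δ̃) =
lim_{k→∞} ∂^{(i)}(δ̃^{(k)})`") for his setting, here as an INLINE hypothesis at `p = 3` under the
route's binders (not a tree fact; nothing asserted). [cite: Kim2022StructureSelmer, §1.5.1 (PDF p. 7)]
[cite: Kim2025RefinedTNC, Thm 1.1] -/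
theorem shallowEqDeepAtTorsionFree_of_forall_partial_eq_deep
    (H : ∀ (W : WeierstrassCurve ℚ) [W.IsElliptic] [W.IsGloballyMinimal],
      (∀ n : ℕ, W.HasSurjectiveModNGaloisRep (3 ^ n : ℕ)) →
      Nat.card {Q : (W.baseChange ℚ_[3]).toAffine.Point // (3 : ℕ) • Q = 0} = 1 → Finite W.sha →
      ∀ {N : ℕ} [NeZero N] (f : CuspForm (Gamma0 N) 2), IsNewformOf W f →
      (∀ r : ℚ, ratPlusSymbol f r ≠ 0 → 0 ≤ padicValRat 3 (ratPlusSymbol f r)) →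
      kuriharaVanishingOrder W 3 f = 0 →
      ∀ i : ℕ, 0 < i → kuriharaPartial W 3 f i = kuriharaPartialDeep W 3 f i) :
    ShallowEqDeepAtTorsionFree := by
  intro W _ _ htower ht0 hfin N _ f hf hint hord
  exact kuriharaPartialDeepInfty_le_kuriharaPartialInfty_of_forall_partial_eq_deep W 3 f
    (H W htower ht0 hfin f hf hint hord)

end Summit.BirchSwinnertonDyer.BirchSwinnertonDyer.Theorems.KimAtThreeShallowEqDeepLevelRegularity

end
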